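import Summits.ValiantsHypothesis.ValiantsHypothesis.Theses.ValuativeGCT

/-!
# `ValuativeGCT.CutBites` (stmt-ValiantsHypothesis-12626), line adjugate-pfaffian-kernel — Stub 5 `stub_adjDet_isHomogeneous`

The witness of the line, `W_m = det (Σ_k cof X_(k,k))` — where `X_(k,k)` is the `m × m` matrix of the
coordinate functions `X (toLex (k, k), toLex (a, b))` of row `(k,k)` of `A ∈ End(ℂ^{m×m})` and
`cof Y = Y.adjugateᵀ` — is a form of degree `m(m-1)` in the `m⁴` variables `MatIdx m × MatIdx m`.

Mathematics: the determinant of a square matrix of forms whose `i`-th row consists of forms of degree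
`r i` is a form of degree `Σ r i` (Leibniz expansion `Matrix.det_apply`, `IsHomogeneous.prod/.sum`);
hence every entry of the adjugate of a matrix of linear forms (a determinant with one row replaced by
a standard basis vector, `Matrix.adjugate_apply`) is a form of degree `m - 1`, so is every entry of
`Σ_k cof X_(k,k)`, and the determinant of an `m × m` matrix of degree-`(m-1)` forms is a form of degree
`m(m-1)`.  The degenerate sizes `m = 0, 1` (witness `= 1`, degree `0`) are covered by the same argument.
This is the degree bookkeeping that places `W_m` in the crux's `homogeneousSubmodule _ ℂ (m * δ)`,
`δ = m - 1`.  The two helper lemmas are adapted from the tree's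
`Literature.AlgebraicGeometry.DeterminantalHypersurfaces.isHomogeneous_det_of_rows` /
`isHomogeneous_adjugate_of_linear` (not in this file's import closure). [folklore]
-/

namespace Summit.ValiantsHypothesis.ValiantsHypothesis.Theorems.CutBitesAdjugate

open Literature.NumberTheory.DiophantineGeometry Literature.Computability.AlgebraicComplexity
open MvPolynomial
open scoped BigOperators Matrix

-- `Summit.ValiantsHypothesis.ValiantsHypothesis.…` is the tree's mandated single-conjunct layout (Sub = Summit).
set_option linter.dupNamespace false

/-- The determinant of a square matrix of forms whose `i`-th row consists of forms of degree `r i` is a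
form of degree `∑ i, r i` (Leibniz expansion). [folklore] -/
theorem cbAdj_isHomogeneous_det_of_rows {σ : Type*} {S : Type*} [CommRing S] {ι : Type*} [Fintype ι]
    [DecidableEq ι] {Y : Matrix ι ι (MvPolynomial σ S)} {r : ι → ℕ}
    (h : ∀ i j, (Y i j).IsHomogeneous (r i)) : Y.det.IsHomogeneous (∑ i, r i) := by
  -- adapted from Literature.AlgebraicGeometry.DeterminantalHypersurfaces.isHomogeneous_det_of_rows
  rw [Matrix.det_apply]
  refine IsHomogeneous.sum _ _ _ fun τ _ => ?_
  have hp : (∏ i, Y (τ i) i).IsHomogeneous (∑ i, r i) := by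
    have := IsHomogeneous.prod Finset.univ (fun i => Y (τ i) i) (fun i => r (τ i))
      (fun i _ => h _ _)
    rwa [Equiv.sum_comp τ r] at this
  rw [Units.smul_def]
  exact (mem_homogeneousSubmodule _ _).mp
    (zsmul_mem ((mem_homogeneousSubmodule _ _).mpr hp) _)

/-- The determinant of a square matrix all of whose entries are forms of degree `d` is a form of degree
`(size) * d`. [folklore] -/
theorem cbAdj_isHomogeneous_det_of_const {σ : Type*} {S : Type*} [CommRing S] {ι : Type*} [Fintype ι]
    [DecidableEq ι] {Y : Matrix ι ι (MvPolynomial σ S)} {d : ℕ}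
    (h : ∀ i j, (Y i j).IsHomogeneous d) : Y.det.IsHomogeneous (Fintype.card ι * d) := by
  have := cbAdj_isHomogeneous_det_of_rows (r := fun _ => d) h
  simpa using this

/-- Every entry of the adjugate of a square matrix of linear forms is a form of degree `size - 1`
(`Matrix.adjugate_apply`: a determinant with one row replaced by a standard basis vector). [folklore] -/
theorem cbAdj_isHomogeneous_adjugate_of_linear {σ : Type*} {S : Type*} [CommRing S] {ι : Type*}
    [Fintype ι] [DecidableEq ι] {Y : Matrix ι ι (MvPolynomial σ S)}
    (h : ∀ i j, (Y i j).IsHomogeneous 1) (i j : ι) :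
    (Y.adjugate i j).IsHomogeneous (Fintype.card ι - 1) := by
  -- adapted from Literature.AlgebraicGeometry.DeterminantalHypersurfaces.isHomogeneous_adjugate_of_linear
  rw [Matrix.adjugate_apply]
  have hsum : ∑ l, Function.update (fun _ : ι => 1) j 0 l = Fintype.card ι - 1 := by
    rw [Finset.sum_update_of_mem (Finset.mem_univ j), zero_add, Finset.sum_const, smul_eq_mul,
      mul_one, Finset.card_univ_sdiff, Finset.card_singleton]
  rw [← hsum]
  refine cbAdj_isHomogeneous_det_of_rows fun i' j' => ?_
  rw [Matrix.updateRow_apply]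
  by_cases hi' : i' = j
  · subst hi'
    rw [if_pos rfl, Function.update_self, Pi.single_apply]
    split_ifs
    · exact isHomogeneous_one σ S
    · exact isHomogeneous_zero σ S 0
  · rw [if_neg hi', Function.update_of_ne hi']
    exact h i' j'

/-- **Stub 5 — the witness is a form of degree `m(m-1)`**: every entry of `cof X_k` is a form of degree
`m-1` (`Matrix.adjugate_apply`: a determinant with one row replaced by `Pi.single _ 1`; Leibniz
expansion, `IsHomogeneous.sum/.prod`, `isHomogeneous_X`), so is every entry of the sum `Σ_k cof X_k`,
and the determinant of an `m × m` matrix of degree-`d` forms is a form of degree `m·d`.  `m = 0, 1`: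
the witness is `1`, degree `0`. [folklore] -/
theorem stub_adjDet_isHomogeneous (m : ℕ) :
    (Matrix.det (∑ k : Fin m, (Matrix.of fun a b : Fin m =>
        (X (toLex (k, k), toLex (a, b)) : MvPolynomial (MatIdx m × MatIdx m) ℂ)).adjugateᵀ)).IsHomogeneous
      (m * (m - 1)) := by
  have h := cbAdj_isHomogeneous_det_of_const (ι := Fin m) (d := m - 1)
    (Y := ∑ k : Fin m, (Matrix.of fun a b : Fin m =>
      (X (toLex (k, k), toLex (a, b)) : MvPolynomial (MatIdx m × MatIdx m) ℂ)).adjugateᵀ)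
    fun i j => ?_
  · simpa only [Fintype.card_fin] using h
  · rw [Matrix.sum_apply]
    refine IsHomogeneous.sum _ _ _ fun k _ => ?_
    rw [Matrix.transpose_apply]
    have hk := cbAdj_isHomogeneous_adjugate_of_linear
      (Y := Matrix.of fun a b : Fin m =>
        (X (toLex (k, k), toLex (a, b)) : MvPolynomial (MatIdx m × MatIdx m) ℂ))
      (fun a b => isHomogeneous_X ℂ _) j i
    simpa only [Fintype.card_fin] using hk

end Summit.ValiantsHypothesis.ValiantsHypothesis.Theorems.CutBitesAdjugate
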